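import Summits.CriticalPhenomena.PercolationContinuityZ3.Theorems.Transplant.Z3NetFilmCustomers
import Summits.CriticalPhenomena.PercolationContinuityZ3.Theorems.Transplant.Z3RungDilutedAudit
import Summits.CriticalPhenomena.PercolationContinuityZ3.Theorems.Transplant.Z3RungDilutedSqp
import Summits.CriticalPhenomena.PercolationContinuityZ3.Theorems.Transplant.Z3NetLinear
import Summits.CriticalPhenomena.PercolationContinuityZ3.Theorems.Transplant.SkeletonStabiliserObstruction
import HarnessLib

/-!
# Class C1b CATALOGUE, gen 12: the `Z3Net` series in one conjunction — the generic device (`SignData ⇒ θ(p_c) = 0`), the rung-diluted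
# cubic lattices (bulk, films, audit, cross-check with gen 11's `Sqp`), the tall Cayley graphs re-derived, change of basis

builds on p205010 (kernel theorem, internal audit signed; external expert review pending) — every continuity statement below runs through the
closed multi-type D″ node `samePDropOfSkeletonSign_holds` (near-one gluing from `AdditiveGluing`, which builds on p205010).
Status sentence (coordinator 2026-08-20T04:30Z): "θ(p_c) = 0 on ℤ^d, all d ≥ 2 — kernel-verified (Lean 4/Mathlib, standard axioms); internal
adversarial audit SIGNED 2026-08-20 04:29Z; external expert review pending."
Lane `prim-bschramm`, seat `prim-bschramm-p2` (gen 12; class C1b "other 3D lattices / slabs / films at their own critical points", METHOD = input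
substitution); helper file (`--supports stmt-CriticalPhenomena-4575 --as helper`); PROOFS ONLY (pattern = g11's `C1bCatalogueTallCds`).
Memo: `HOME/bschramm/P2-LATTICES.md` §36.  SCOPE GUARD (literature desk S195): nothing is claimed for Kesten-periodic graphs WITHOUT sign data.
* **`c1bGen12_catalogue`** — (1) the device: every net on `ℤ³` with `SignData` has `θ(v,p_c) = 0` at every vertex; (2) every rung-diluted cubic
  lattice, every vertex; (3) every (001)-film of every rung-diluted cubic lattice, every vertex; (4) the striped net is quasi-transitive but not
  vertex-transitive; (5) `pcu` is `ℤ³` and `alternating` is gen 11's `Sqp` net; (6) tall Cayley graphs with `(+,−,ε)·S ⊆ S`; (7) change of basis;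
  (8) the LIMIT of the interfaces (stabiliser obstruction, any chart): the row-diluted `R_k` and column-diluted `C_k`, `k ≥ 3`, carry no
  `PlanarSkeletonNeg` at all; `R_2` = striped and `C_2` = sparse are covered.
* `c1bGen12_scope` — connected / quasi-transitive / `p_c < 1` / `1/5 ≤ p_c ≤ 1/2` / `θ(v,1) = 1` for the rung-diluted family.
[cite: BenjaminiSchramm1996, §2, Conj. 4 / Question 3] [cite: KozmaNitzan2024, §1 p. 2 (approach 1), §4 p. 16 (Lemma 8)]
[cite: DuminilCopinSidoraviciusTassion2016, Thm. 1] [cite: GrimmettPercolation1999, §12.1 p. 349]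
-/

noncomputable section

namespace Summit.CriticalPhenomena.PercolationContinuityZ3.Theorems.Transplant

open MeasureTheory Literature.Probability.Percolation Literature.Probability.LatticeModels SimpleGraph
open Literature.Barriers.CriticalPhenomena (IsQuasiTransitive IsGraphTransitive)
open scoped Classical

/-- **THE GEN-12 C1b CATALOGUE** (one conjunction; every conjunct is a named tree theorem of the `Z3Net` series).  builds on p205010 (kernel
theorem, internal audit signed; external expert review pending). [cite: BenjaminiSchramm1996, Conj. 4 / Question 3] -/
theorem c1bGen12_catalogue :
    -- (1) THE DEVICE: sign data ⇒ θ(p_c) = 0 at every vertex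
    (∀ (N : Z3Net) (_ : N.SignData) (v : Site 3), theta N.graph v (criticalProbIOf N.graph v) = 0) ∧
    -- (2) every rung-diluted cubic lattice, every vertex
    (∀ (P : RungPattern) (v : Site 3), theta P.net.graph v (criticalProbIOf P.net.graph v) = 0) ∧
    -- (3) every (001)-film of every rung-diluted cubic lattice, every vertex
    (∀ (P : RungPattern) (a b : ℤ) (v : Z3Net.film a b),
      theta (P.net.graph.induce (Z3Net.film a b)) v (criticalProbIOf (P.net.graph.induce (Z3Net.film a b)) v) = 0) ∧
    -- (4) the striped member is quasi-transitive but NOT vertex-transitive (degrees 6 / 4)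
    (IsQuasiTransitive RungPattern.striped.net.graph ∧ ¬ IsGraphTransitive RungPattern.striped.net.graph) ∧
    -- (5) identifications: pcu is ℤ³; alternating is gen 11's alternating-rung net
    (RungPattern.pcu.net.graph = zdGraph 3 ∧ Nonempty (RungPattern.alternating.net.graph ≃g Sqp.graph)) ∧
    -- (6) every tall Cayley graph with ONE sign vector (+,−,ε) preserving S, every vertex
    (∀ (T : TallGens) (ε : ℤˣ), (∀ s ∈ T.S, Z3Net.sgn ![1, -1, ε] s ∈ T.S) → ∀ v : Site 3, theta T.graph v (criticalProbIOf T.graph v) = 0) ∧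
    -- (7) change of basis: sign data in any lattice basis
    (∀ (N : Z3Net) (A : Site 3 ≃+ Site 3) (_ : (N.mapEquiv A).SignData) (v : Site 3), theta N.graph v (criticalProbIOf N.graph v) = 0) ∧
    -- (8) the limit of the interfaces: `R_k`, `C_k` (k ≥ 3) carry no `PlanarSkeletonNeg` (any chart); `R_2` = striped, `C_2` = sparse are covered
    ((∀ k : ℕ, 3 ≤ k → IsEmpty (PlanarSkeletonNeg (Z3Net.rowNet k).graph) ∧ IsEmpty (PlanarSkeletonNeg (Z3Net.colNet k).graph)) ∧
      (∀ v : Site 3, theta (Z3Net.rowNet 2).graph v (criticalProbIOf (Z3Net.rowNet 2).graph v) = 0) ∧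
      ∀ v : Site 3, theta (Z3Net.colNet 2).graph v (criticalProbIOf (Z3Net.colNet 2).graph v) = 0) :=
  ⟨fun _ D v => D.criticalContinuity v, fun P v => P.criticalContinuity v, fun P a b v => P.film_criticalContinuity a b v,
    ⟨RungPattern.striped_quasiTransitive, RungPattern.striped_not_transitive⟩,
    ⟨RungPattern.pcu_net_graph, ⟨RungPattern.alternatingIsoSqp⟩⟩, fun T ε hε v => T.criticalContinuity_of_sgn ε hε v,
    fun N A D v => N.criticalContinuity_of_mapEquiv A D v,
    ⟨fun _ hk => ⟨Z3Net.rowNet_isEmpty_skeletonNeg hk, Z3Net.colNet_isEmpty_skeletonNeg hk⟩, Z3Net.rowNet_two_criticalContinuity,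
      Z3Net.colNet_two_criticalContinuity⟩⟩

/-- **SCOPE of the rung-diluted family**: every member is connected and quasi-transitive, `1/5 ≤ p_c(0)`, `p_c(ℤ³,v) ≤ p_c(v) ≤ 1/2`, `θ(v,1) = 1`
— every hypothesis of Benjamini–Schramm's Conjecture 4 with room on both sides of `p_c`. [cite: BenjaminiSchramm1996, Conj. 4 and §2] -/
theorem c1bGen12_scope (P : RungPattern) :
    P.net.graph.Connected ∧ IsQuasiTransitive P.net.graph ∧ 1 / 5 ≤ criticalProb P.net.graph (0 : Site 3) ∧
      (∀ v : Site 3, criticalProb (zdGraph 3) v ≤ criticalProb P.net.graph v ∧ criticalProb P.net.graph v ≤ 1 / 2) ∧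
      ∀ v : Site 3, theta P.net.graph v 1 = 1 :=
  ⟨P.signData.graph_connected, P.signData.graph_quasiTransitive, P.one_fifth_le_criticalProb, P.criticalProb_bounds, P.theta_one⟩

end Summit.CriticalPhenomena.PercolationContinuityZ3.Theorems.Transplant

end
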